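import Literature.Algebra.EuclideanLattices.MRLemma510Law
import Literature.Algebra.EuclideanLattices.MRLemma510Machine
import Literature.Computability.Cryptography.GapSVPFromShortDualSets
import Literature.Algebra.EuclideanLattices.RegevDualQuery
import Literature.Algebra.EuclideanLattices.LatticeTableCodeFP
import Literature.Algebra.EuclideanLattices.GapInstanceCodeFP
import Literature.Computability.Complexity.PlumbingBricks
import Mathlib.Analysis.Complex.Exponential
import HarnessLib

/-!
# Micciancio–Regev 2007, Cor. 5.13 on the dual lattice at machine level from an `IncGDD` solver machine, and `owfExist_of_gapSVP_worstCaseHard` from a machine-level Thm. 5.9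

Topic `Algebra/EuclideanLattices` (family `pqc`). Assembly of the machine-level Lemma 5.10
(`MRLemma510Function` / `MRLemma510Machine` / `MRLemma510Law`) into the first step of the proof of
MR07 Thm. 5.23 (authors' version p. 29: "using Corollary 5.13 (with `F` as an oracle), we obtain a set of
`n` linearly independent vectors `S` in `L(B)*` such that `‖S‖ ≤ 8β√n η_ε(B*)`"), i.e. into the hypothesis
of the verifier-free route `Literature.Computability.Cryptography.owfExist_of_gapSVP_worstCaseHard_of_shortDual`
to the named fact `Literature.Computability.Cryptography.owfExist_of_gapSVP_worstCaseHard`: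

* the dual context: `dualRows I` (the columns `gₖ` of Cohen's integral inverse `G`, `B G = D I = G B`,
  `D = det(B)²`, `IntegerMatrixInverseGS`), `dualCtx`, `wf_dualCtx`, and **`lattice_dualCtx_eq`**:
  `L(Gᵀ) = D · L(B)*` (`gₖ/D ∈ L(B)*`; `D y = G (B y) = ∑ₖ ⟨y, bₖ⟩ gₖ` for `y ∈ L(B)*`);
* `output_mem_shortDualOutputs` — good stopped rows `V` with `√A ≤ G η_{2⁻ⁿ}(D L(B)*)` give
  `⟨bin D, code (n, V)⟩ ∈ shortDualOutputs I (G √n)` (MR07 Lemma 3.2 through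
  `GapSVPFromDualSets.norm_mul_minNorm_le_of_le_smoothing`, `(D L(B)*)* = D⁻¹ L(B)`,
  `RegevDualQuery.minNorm_pointwise_smul`);
* the reduction `runOn Sol pk pP pK pT I r` (loop of Lemma 5.10 on the integral dual with parameters
  polynomial in `ℓ = |code I|`) and `runOn_codeFP` (typed polynomial time, from `loopOut_codeFP` and a
  PPT `Sol`);
* **`shortDual_hypothesis_of_incGDDMachine`** — from a machine-level Thm. 5.9 (hypothesis `H59`, inline:
  a PPT solver of well-formed integer `IncGDD` instances `MRLemma510.IncGDDInst` under the promise
  `r > g(n) η_{2⁻ⁿ}(L(U))`, success `≥ 1/n^e` for `n ∈ S`, `n ≥ n₀`, from any PPT `SIS′` solver with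
  polynomial advantage on `S`) the hypothesis of `owfExist_of_gapSVP_worstCaseHard_of_shortDual` with
  quality `16 g(n) n`: parameters `W = ℓ + Q₁(ℓ)`, `T = 32W²` rounds (`(7/8)^{32W²} 4^{W²} < 1` beats the
  potential), `k₀ = ℓ^e W` calls per round (`T(1 − 1/n^e)^{k₀} ≤ 32W² e^{−W} ≤ 1/3` for `W ≥ 48`),
  padding `P = P₀(2W + 2)`, word width `K = pS(P)`; success probability `≥ 2/3` by
  `MRLemma510Law.toReal_loopOut_bad_le`;
* `shortDual_hypothesis_of_dualIncGDDMachine` / `…_of_incGDDMachine` — the main theorem with the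
  solver asked only on the integral duals `U = dualRows I` (all the reduction needs), resp. on every
  integer lattice (Thm. 5.9 proper);
* **`owfExist_of_gapSVP_worstCaseHard_of_incGDDMachine`**, `…_of_dualIncGDDMachine` — hence the target
  fact from `H59` alone.

So along this route what separates `owfExist_of_gapSVP_worstCaseHard` from a proof is exactly the
machine of Thm. 5.9 (the sampling and combining procedures of Lemmas 5.7–5.8 realised on a probabilistic
machine within its promise), in the interface `H59`. All proved; no named fact.

## References

* D. Micciancio, O. Regev, *Worst-case to average-case reductions based on Gaussian measures*,
  SIAM J. Comput. 37 (2007) 267–302; authors' version (`lit read doi:10.1137/S0097539705447360`):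
  Lemma 3.2 (p. 11), Def. 5.6 (p. 19), Thm. 5.9 (p. 22), Lemma 5.10 and Cor. 5.13 (pp. 24–25), Thm. 5.23
  and the first step of its proof (pp. 28–29).
* D. Micciancio, S. Goldwasser, *Complexity of Lattice Problems*, Kluwer 2002, Ch. 1 §1 (the dual lattice
  `L(B)* = L((B⁻¹)ᵀ)`, scaling) [MicciancioGoldwasser2002].
* H. Cohen, *A Course in Computational Algebraic Number Theory*, GTM 138, 1993, §2.6.3 [Cohen1993].
* M. Ajtai, *Generating hard instances of lattice problems*, STOC 1996, Thm. 1.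
* S. Arora, B. Barak, *Computational Complexity: A Modern Approach*, CUP 2009, §1.3, Def. 7.1 [AroraBarak2009].
-/

noncomputable section

namespace Literature.Algebra.EuclideanLattices

namespace MRLemma510

open _root_.Computability Literature.Computability.Complexity Literature.Computability.Complexity.CodeFP
  Literature.Computability.Complexity.Brick Literature.Computability.Complexity.LMat GSInverse Polynomial
  Literature.Computability.Cryptography Literature.Computability.Cryptography.LWE MeasureTheory PMF GapCodes Plumb
open scoped ENNReal Pointwise RealInnerProductSpace

/-! ### The dual context of a lattice instance -/

/-- The basis rows of an instance as a list matrix (`= rowsOf B = matRows B`). [folklore] -/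
def basisRows (I : LatticeInstance) : List (List ℤ) := rowsOf I.basis

/-- **The integral dual rows**: the columns `gₖ` of Cohen's integral inverse `G` (`B G = det(B)² I`), i.e.
the rows of `Gᵀ = det(B)² (B⁻¹)ᵀ`, an integer basis of `det(B)² · L(B)*`.
[cite: MicciancioGoldwasser2002, Ch. 1 §1 (L(B)* = L((B⁻¹)ᵀ)); Cohen1993 §2.6.3] -/
def dualRows (I : LatticeInstance) : List (List ℤ) := invCols (basisRows I)

/-- **The denominator `D = det(B)²`.** [cite: Cohen1993, §2.6.3] -/
def dualDen (I : LatticeInstance) : ℤ := invDen (basisRows I)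

/-- The context of the loop run on the integral dual: dimension `n`, rows of `Gᵀ`, `k₀` calls per
round, padding length `P`. [cite: MicciancioRegev2007, Thm. 5.23 (proof, p. 29: Cor. 5.13 applied to L(B)*)] -/
abbrev dualCtx (I : LatticeInstance) (k₀ P : ℕ) : Ctx := ⟨I.n, dualRows I, k₀, P⟩

variable {I : LatticeInstance}

/-- `basisRows` is square. [folklore] -/
theorem length_basisRows (I : LatticeInstance) : (basisRows I).length = I.n := length_rowsOf _

/-- `dualRows` has `n` rows. [folklore] -/
theorem length_dualRows (I : LatticeInstance) : (dualRows I).length = I.n := by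
  rw [dualRows, length_invCols, length_basisRows]

/-- Rows of `dualRows` have length `n`. [folklore] -/
theorem length_of_mem_dualRows {r : List ℤ} (h : r ∈ dualRows I) : r.length = I.n := by
  simp only [dualRows, invCols, List.mem_map, List.mem_range] at h
  obtain ⟨k, -, rfl⟩ := h
  rw [length_invCol, length_basisRows]

/-- **Entries of the dual rows**: `ent (dualRows I) i j = (invMatrix B)ᵀ i j = G j i`. [folklore] -/
theorem ent_dualRows (i j : Fin I.n) : ent (dualRows I) i j = invMatrix I.basis j i := by
  rw [invMatrix_apply, ent, dualRows, invCols, length_basisRows, getD_map_range _ i.isLt]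
  rfl

/-- `toMat n n (dualRows I) = Gᵀ`. [folklore] -/
theorem toMat_dualRows (I : LatticeInstance) : toMat I.n I.n (dualRows I) = (invMatrix I.basis).transpose := by
  funext i j; exact ent_dualRows i j

/-- `D = det(B)²` for a nonsingular instance. [cite: Cohen1993, §2.6.3] -/
theorem dualDen_eq (hI : I.IsNonsingular) : dualDen I = I.basis.det ^ 2 := invDen_eq_det_sq hI

/-- `D > 0` for a nonsingular instance. [folklore] -/
theorem dualDen_pos (hI : I.IsNonsingular) : 0 < dualDen I := by
  rw [dualDen_eq hI]
  exact lt_of_le_of_ne (sq_nonneg _) (Ne.symm (pow_ne_zero 2 hI))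

/-- `B G = D I`. [cite: Cohen1993, §2.6.3] -/
theorem basis_mul_invMatrix (hI : I.IsNonsingular) :
    I.basis * invMatrix I.basis = (dualDen I) • (1 : Matrix (Fin I.n) (Fin I.n) ℤ) := by
  rw [dualDen_eq hI]; exact mul_invMatrix hI

/-- `G B = D I` (a one-sided inverse of a square matrix is two-sided: pass to `ℝ`, where
`G = det(B)² B⁻¹`, `IntegerMatrixInverseGS.inv_eq_smul_invMatrix`). [folklore] -/
theorem invMatrix_mul_basis (hI : I.IsNonsingular) :
    invMatrix I.basis * I.basis = (dualDen I) • (1 : Matrix (Fin I.n) (Fin I.n) ℤ) := by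
  have hinj : Function.Injective (fun M : Matrix (Fin I.n) (Fin I.n) ℤ => M.map (Int.cast : ℤ → ℝ)) :=
    fun M M' h => Matrix.ext fun i j => by
      have := congrFun (congrFun h i) j
      simpa [Matrix.map_apply] using this
  apply hinj
  have hdet : IsUnit (I.basis.map (Int.cast : ℤ → ℝ)).det := by
    rw [show I.basis.map (Int.cast : ℤ → ℝ) = (Int.castRingHom ℝ).mapMatrix I.basis from rfl, ← RingHom.map_det,
      isUnit_iff_ne_zero, eq_intCast]
    exact_mod_cast hI
  have hd2 : ((I.basis.det : ℝ) ^ 2) ≠ 0 := pow_ne_zero 2 (by exact_mod_cast hI)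
  have hG : (invMatrix I.basis).map (Int.cast : ℤ → ℝ) = ((I.basis.det : ℝ) ^ 2) • (I.basis.map (Int.cast : ℤ → ℝ))⁻¹ := by
    rw [inv_eq_smul_invMatrix hI, smul_smul, mul_inv_cancel₀ hd2, one_smul]
  have e2 : (invMatrix I.basis * I.basis).map (Int.cast : ℤ → ℝ) =
      (invMatrix I.basis).map (Int.cast : ℤ → ℝ) * I.basis.map (Int.cast : ℤ → ℝ) :=
    Matrix.map_mul (f := Int.castRingHom ℝ)
  show (invMatrix I.basis * I.basis).map (Int.cast : ℤ → ℝ) =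
    (dualDen I • (1 : Matrix (Fin I.n) (Fin I.n) ℤ)).map (Int.cast : ℤ → ℝ)
  rw [e2, hG, Matrix.smul_mul, Matrix.nonsing_inv_mul _ hdet, dualDen_eq hI]
  ext i j
  rw [Matrix.map_apply, Matrix.smul_apply, Matrix.smul_apply, Matrix.one_apply, Matrix.one_apply]
  split_ifs <;> simp

/-- **The dual context is well formed** on a nonsingular instance of positive dimension. [folklore] -/
theorem wf_dualCtx (hI : I.IsNonsingular) (hn : 1 ≤ I.n) (k₀ P : ℕ) : (dualCtx I k₀ P).WF where
  one_le_n := hn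
  len_U := length_dualRows I
  row_U := fun _ hr => length_of_mem_dualRows hr
  det_U := by
    change (toMat I.n I.n (dualRows I)).det ≠ 0
    rw [toMat_dualRows, Matrix.det_transpose]
    intro h0
    have h := congrArg Matrix.det (basis_mul_invMatrix hI)
    rw [Matrix.det_mul, h0, mul_zero, Matrix.det_smul, Matrix.det_one, mul_one] at h
    exact pow_ne_zero _ (dualDen_pos hI).ne' h.symm

/-! ### The lattice of the dual context is `D · L(B)*` -/

/-- The rows of the dual context read in `ℝⁿ` are the columns of `G`. [folklore] -/
theorem rowVec_dualRows (i : Fin I.n) :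
    IncGDDInst.rowVec I.n (dualRows I) i = intVecToEuclidean I.n fun t => invMatrix I.basis t i := by
  change intVecToEuclidean I.n (fun t => ent (dualRows I) i t) = _
  congr 1; funext t; exact ent_dualRows i t

/-- **`⟨gₖ, bᵢ⟩ = (B G)ᵢₖ = D δᵢₖ`.** [cite: Cohen1993, §2.6.3] -/
theorem inner_rowVec_dualRows_vec (hI : I.IsNonsingular) (k i : Fin I.n) :
    ⟪IncGDDInst.rowVec I.n (dualRows I) k, I.vec i⟫ = (dualDen I : ℝ) * (if i = k then 1 else 0) := by
  have hBG := congrFun (congrFun (basis_mul_invMatrix hI) i) k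
  rw [Matrix.mul_apply, Matrix.smul_apply, Matrix.one_apply, smul_eq_mul] at hBG
  have hcast := congrArg (fun z : ℤ => (z : ℝ)) hBG
  simp only [Int.cast_sum, Int.cast_mul, Int.cast_ite, Int.cast_one, Int.cast_zero] at hcast
  rw [← hcast, rowVec_dualRows]
  simp [LatticeInstance.vec, PiLp.inner_apply, intVecToEuclidean_apply, mul_comm]

/-- **`gₖ / D ∈ L(B)*`.** [cite: MicciancioGoldwasser2002, Ch. 1 §1 (L(B)* = L((B⁻¹)ᵀ))] -/
theorem inv_dualDen_smul_rowVec_mem_dualLattice (hI : I.IsNonsingular) (k : Fin I.n) :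
    ((dualDen I : ℝ))⁻¹ • IncGDDInst.rowVec I.n (dualRows I) k ∈ dualLattice I.lattice := by
  rw [LatticeInstance.mem_dualLattice_iff_forall_vec]
  intro i
  have hD : (dualDen I : ℝ) ≠ 0 := by exact_mod_cast (dualDen_pos hI).ne'
  have h : ⟪((dualDen I : ℝ))⁻¹ • IncGDDInst.rowVec I.n (dualRows I) k, I.vec i⟫ = if i = k then 1 else 0 := by
    rw [real_inner_smul_left, inner_rowVec_dualRows_vec hI k i, ← mul_assoc, inv_mul_cancel₀ hD, one_mul]
  by_cases hik : i = k
  · exact ⟨1, by rw [h, if_pos hik, Int.cast_one]⟩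
  · exact ⟨0, by rw [h, if_neg hik, Int.cast_zero]⟩

/-- The rows of the dual context lie in its lattice. [folklore] -/
theorem rowVec_dualRows_mem (k₀ P : ℕ) (k : Fin I.n) : IncGDDInst.rowVec I.n (dualRows I) k ∈ (dualCtx I k₀ P).lattice :=
  Submodule.subset_span (Set.mem_range_self k)

/-- **`L(Gᵀ) ⊆ D · L(B)*`.** [cite: MicciancioGoldwasser2002, Ch. 1 §1] -/
theorem lattice_dualCtx_le (hI : I.IsNonsingular) (k₀ P : ℕ) :
    (dualCtx I k₀ P).lattice ≤ (dualDen I : ℝ) • dualLattice I.lattice := by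
  refine Submodule.span_le.2 ?_
  rintro _ ⟨k, rfl⟩
  have hD : (dualDen I : ℝ) ≠ 0 := by exact_mod_cast (dualDen_pos hI).ne'
  refine (Submodule.mem_smul_pointwise_iff_exists _ _ _).2
    ⟨((dualDen I : ℝ))⁻¹ • IncGDDInst.rowVec I.n (dualRows I) k, inv_dualDen_smul_rowVec_mem_dualLattice hI k, ?_⟩
  rw [smul_smul, mul_inv_cancel₀ hD, one_smul]
  rfl

/-- **`D · L(B)* ⊆ L(Gᵀ)`**: for `y ∈ L(B)*`, `D y = G (B y) = ∑ₖ ⟨y, bₖ⟩ gₖ` with integer coefficients.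
[cite: MicciancioGoldwasser2002, Ch. 1 §1] -/
theorem smul_dualLattice_le_lattice_dualCtx (hI : I.IsNonsingular) (k₀ P : ℕ) :
    (dualDen I : ℝ) • dualLattice I.lattice ≤ (dualCtx I k₀ P).lattice := by
  intro x hx
  rw [Submodule.mem_smul_pointwise_iff_exists] at hx
  obtain ⟨y, hy, rfl⟩ := hx
  -- the integer coefficients `zₖ = ⟨y, bₖ⟩`
  have hcoef := fun k => (LatticeInstance.mem_dualLattice_iff_forall_vec (I := I) y).1 hy k
  choose z hz using hcoef
  have hGB := invMatrix_mul_basis hI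
  have hrow : ∀ t j : Fin I.n, ∑ k, ((invMatrix I.basis t k : ℤ) : ℝ) * ((I.basis k j : ℤ) : ℝ) =
      (dualDen I : ℝ) * (if t = j then 1 else 0) := by
    intro t j
    have h := congrFun (congrFun hGB t) j
    rw [Matrix.mul_apply, Matrix.smul_apply, Matrix.one_apply, smul_eq_mul] at h
    have := congrArg (fun w : ℤ => (w : ℝ)) h
    simp only [Int.cast_sum, Int.cast_mul, Int.cast_ite, Int.cast_one, Int.cast_zero] at this
    exact this
  have hz' : ∀ k, (z k : ℝ) = ∑ j, y j * ((I.basis k j : ℤ) : ℝ) := by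
    intro k
    rw [hz k]
    simp only [LatticeInstance.vec, PiLp.inner_apply, intVecToEuclidean_apply, RCLike.inner_apply, conj_trivial]
    exact Finset.sum_congr rfl fun j _ => by ring
  -- `D y = ∑ₖ zₖ gₖ`
  have key : (dualDen I : ℝ) • y = ∑ k, (z k) • IncGDDInst.rowVec I.n (dualRows I) k := by
    ext t
    have e1 : ((dualDen I : ℝ) • y) t = (dualDen I : ℝ) * y t := rfl
    have e2 : (∑ k, (z k) • IncGDDInst.rowVec I.n (dualRows I) k) t =
        ∑ k, (z k : ℝ) * ((invMatrix I.basis t k : ℤ) : ℝ) := by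
      rw [WithLp.ofLp_sum, Finset.sum_apply]
      refine Finset.sum_congr rfl fun k _ => ?_
      rw [← Int.cast_smul_eq_zsmul ℝ, WithLp.ofLp_smul, Pi.smul_apply, smul_eq_mul, rowVec_dualRows,
        intVecToEuclidean_apply]
    rw [e1, e2]
    calc (dualDen I : ℝ) * y t = ∑ j, y j * ((dualDen I : ℝ) * (if t = j then 1 else 0)) := by
          rw [Finset.sum_eq_single t (fun j _ hj => by simp [Ne.symm hj]) (by simp)]
          simp [mul_comm]
      _ = ∑ j, y j * ∑ k, ((invMatrix I.basis t k : ℤ) : ℝ) * ((I.basis k j : ℤ) : ℝ) := by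
          refine Finset.sum_congr rfl fun j _ => ?_; rw [hrow t j]
      _ = ∑ k, (∑ j, y j * ((I.basis k j : ℤ) : ℝ)) * ((invMatrix I.basis t k : ℤ) : ℝ) := by
          simp only [Finset.mul_sum, Finset.sum_mul]
          rw [Finset.sum_comm]
          exact Finset.sum_congr rfl fun k _ => Finset.sum_congr rfl fun j _ => by ring
      _ = ∑ k, (z k : ℝ) * ((invMatrix I.basis t k : ℤ) : ℝ) := by
          refine Finset.sum_congr rfl fun k _ => ?_; rw [hz' k]
  rw [key]
  exact Submodule.sum_mem _ fun k _ => Submodule.smul_mem _ (z k) (rowVec_dualRows_mem k₀ P k)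

/-- **The lattice of the dual context is `D · L(B)*`.** [cite: MicciancioGoldwasser2002, Ch. 1 §1 (L(B)* = L((B⁻¹)ᵀ))] -/
theorem lattice_dualCtx_eq (hI : I.IsNonsingular) (k₀ P : ℕ) :
    (dualCtx I k₀ P).lattice = (dualDen I : ℝ) • dualLattice I.lattice :=
  le_antisymm (lattice_dualCtx_le hI k₀ P) (smul_dualLattice_le_lattice_dualCtx hI k₀ P)

/-! ### Good final rows are short dual sets -/

/-- `(c · L*)* = c⁻¹ · L` for a full-rank lattice. [cite: MicciancioGoldwasser2002, Ch. 1 §1] -/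
theorem dualLattice_smul_dualLattice {E : Type*} [NormedAddCommGroup E] [InnerProductSpace ℝ E] [FiniteDimensional ℝ E]
    (L : Submodule ℤ E) [DiscreteTopology L] [IsZLattice ℝ L] {c : ℝ} (hc : c ≠ 0) :
    dualLattice (c • dualLattice L) = c⁻¹ • L := by
  rw [dualLattice_pointwise_smul _ hc, dualLattice_dualLattice]

/-- The dual context's instance is nonsingular. [folklore] -/
theorem isNonsingular_dualCtx (hI : I.IsNonsingular) (hn : 1 ≤ I.n) (k₀ P : ℕ) :
    (⟨I.n, toMat I.n I.n (dualRows I)⟩ : LatticeInstance).IsNonsingular := (wf_dualCtx hI hn k₀ P).det_U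

/-- **The output of a good stopped run is a `λ₁`-short dual set**: if the rows `V` of the dual context
are good and `√A ≤ G · η_{2⁻ⁿ}(D·L(B)*)`, then `⟨bin D, code (n, V)⟩ ∈ shortDualOutputs I (G √n)`:
the rows `vᵢ/D` lie in `L(B)*`, are independent, and `‖vᵢ/D‖ λ₁(L(B)) = ‖vᵢ‖ λ₁((D L(B)*)*) ≤ G √n` by
MR07 Lemma 3.2 (`GapSVPFromDualSets.norm_mul_minNorm_le_of_le_smoothing`) and `(D L(B)*)* = D⁻¹ L(B)`.
[cite: MicciancioRegev2007, Thm. 5.23 (proof, first step, p. 29) with Lemma 3.2 (p. 11)] -/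
theorem output_mem_shortDualOutputs (hI : I.IsNonsingular) (hn : 1 ≤ I.n) {k₀ P : ℕ} {V : List (List ℤ)}
    (hV : GoodRows (dualCtx I k₀ P) V) {G : ℝ} (hG : 0 ≤ G)
    (hshort : Real.sqrt (roundA V) ≤ G * smoothingParameter (dualCtx I k₀ P).lattice ((2⁻¹ : ℝ) ^ I.n)) :
    boolPair (encodeNat (dualDen I).toNat) (LatticeInstance.encode ⟨I.n, toMat I.n I.n V⟩) ∈
      shortDualOutputs I (G * Real.sqrt I.n) := by
  have hD : (0 : ℤ) < dualDen I := dualDen_pos hI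
  have hDr : (0 : ℝ) < (dualDen I : ℝ) := by exact_mod_cast hD
  have hDnat : (((dualDen I).toNat : ℕ) : ℝ) = (dualDen I : ℝ) := by
    have : ((dualDen I).toNat : ℤ) = dualDen I := Int.toNat_of_nonneg hD.le
    exact_mod_cast this
  have hrow : ∀ i : Fin I.n, intVecToEuclidean I.n (toMat I.n I.n V i) = IncGDDInst.rowVec I.n V i := fun i => rfl
  obtain ⟨-, -, -, hle⟩ := goodRows_norms (wf_dualCtx hI hn k₀ P) hV
  refine ⟨(dualDen I).toNat, toMat I.n I.n V, rfl, by have := Int.toNat_le_toNat hD; simpa using Int.lt_toNat.2 hD,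
    fun i => ?_, ?_, fun i => ?_⟩
  · -- membership: `vᵢ ∈ D L(B)*`
    rw [hrow, hDnat]
    have hmem : IncGDDInst.rowVec I.n V i ∈ (dualDen I : ℝ) • dualLattice I.lattice :=
      lattice_dualCtx_le hI k₀ P (hV.mem i i.isLt)
    rw [Submodule.mem_smul_pointwise_iff_exists] at hmem
    obtain ⟨y, hy, hye⟩ := hmem
    rw [← hye, smul_smul, inv_mul_cancel₀ hDr.ne', one_smul]
    exact hy
  · simpa only [hrow] using hV.indep
  · -- the norm: `‖vᵢ‖ λ₁((D L(B)*)*) ≤ G √n` and `(D L(B)*)* = D⁻¹ L(B)`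
    rw [hrow, hDnat]
    haveI : IsZLattice ℝ (⟨I.n, toMat I.n I.n (dualRows I)⟩ : LatticeInstance).lattice :=
      LatticeInstance.isZLattice_of_isNonsingular (isNonsingular_dualCtx hI hn k₀ P)
    haveI : IsZLattice ℝ I.lattice := LatticeInstance.isZLattice_of_isNonsingular hI
    haveI : Nontrivial (EuclideanSpace ℝ (Fin I.n)) := by
      haveI : Nonempty (Fin I.n) := ⟨⟨0, hn⟩⟩
      infer_instance
    have hL'eq : (⟨I.n, toMat I.n I.n (dualRows I)⟩ : LatticeInstance).lattice = (dualDen I : ℝ) • dualLattice I.lattice :=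
      lattice_dualCtx_eq hI k₀ P
    have hvi : ‖IncGDDInst.rowVec I.n V i‖ ≤
        G * smoothingParameter (dualLattice (dualLattice (⟨I.n, toMat I.n I.n (dualRows I)⟩ : LatticeInstance).lattice))
          ((2⁻¹ : ℝ) ^ Module.finrank ℝ (EuclideanSpace ℝ (Fin I.n))) := by
      rw [dualLattice_dualLattice, finrank_euclideanSpace_fin]
      exact (hle i i.isLt).trans hshort
    have h32 := norm_mul_minNorm_le_of_le_smoothing (dualLattice (⟨I.n, toMat I.n I.n (dualRows I)⟩ : LatticeInstance).lattice) hG hvi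
    rw [finrank_euclideanSpace_fin] at h32
    -- `λ₁((D L(B)*)*) = D⁻¹ λ₁(L(B))`
    have hMeq : dualLattice (⟨I.n, toMat I.n I.n (dualRows I)⟩ : LatticeInstance).lattice = (dualDen I : ℝ)⁻¹ • I.lattice := by
      rw [hL'eq]
      exact dualLattice_smul_dualLattice I.lattice hDr.ne'
    have hmin : minNorm (dualLattice (⟨I.n, toMat I.n I.n (dualRows I)⟩ : LatticeInstance).lattice) =
        (dualDen I : ℝ)⁻¹ * minNorm I.lattice := by
      rw [hMeq, minNorm_pointwise_smul _ (inv_ne_zero hDr.ne'), abs_of_pos (inv_pos.2 hDr)]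
    rw [hmin] at h32
    rw [norm_smul, Real.norm_eq_abs, abs_of_pos (inv_pos.2 hDr)]
    calc (dualDen I : ℝ)⁻¹ * ‖IncGDDInst.rowVec I.n V i‖ * minNorm I.lattice
        = ‖IncGDDInst.rowVec I.n V i‖ * ((dualDen I : ℝ)⁻¹ * minNorm I.lattice) := by ring
      _ ≤ G * Real.sqrt I.n := h32

/-! ### The reduction on codes -/

variable (Sol : RandAlg (List Bool) (List Bool)) (pk pP pK pT : Polynomial ℕ)

/-- **The output string**: `⟨bin D, code (n, V)⟩`. [cite: MicciancioRegev2007, Cor. 5.13 (the output S)] -/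
def output (I : LatticeInstance) (V : List (List ℤ)) : List Bool :=
  boolPair (encodeNat (dualDen I).toNat) (LatticeInstance.encode ⟨I.n, toMat I.n I.n V⟩)

/-- **The reduction on a lattice instance with coins `r`**: run the loop of Lemma 5.10 on the integral dual
rows with `k₀ = pk(ℓ)` calls per round, padding length `P = pP(ℓ)`, coin words of width `K = pK(ℓ)` and
`T = pT(ℓ)` rounds (`ℓ = |code I|`), and output the final rows over the denominator `D`.
[cite: MicciancioRegev2007, Thm. 5.23 (proof, first step, p. 29: "using Corollary 5.13 … we obtain S")] -/
def runOn (I : LatticeInstance) (r : List Bool) : List Bool :=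
  output I (loopOut (dualCtx I (pk.eval I.encode.length) (pP.eval I.encode.length)) Sol.run
    (pK.eval I.encode.length) (pT.eval I.encode.length) r).2

/-- A unary polynomial of a unary numeral (the brick `polyFn`). [cite: AroraBarak2009, §1.3] -/
theorem unPoly (p : Polynomial ℕ) : CodeFP unE unE (fun ℓ => p.eval ℓ) :=
  of_fn (polyFn p) (polyFn_mem_FP p) fun ℓ => by rw [polyFn_apply, length_unE, unE_eq_ones]

/-- The code of a lattice instance, unfolded: `⟨bin n, listE smE (row-major entries)⟩`. [cite: MicciancioGoldwasser2002, Ch. 1 §1.2] -/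
theorem li_encode_eq (I : LatticeInstance) : I.encode = pairE natE (listE smE) (I.n, rowMajor I.n (matRows I.basis)) := by
  obtain ⟨n, B⟩ := I
  have hI : (⟨n, B⟩ : LatticeInstance) = ⟨n, toMat n n (matRows B)⟩ := by rw [toMat_matRows]
  rw [hI, latticeInstance_encode_toMat]
  simp [toMat_matRows, pairE]

/-- The instance code as a string value. [folklore] -/
theorem liSelf : CodeFP LatticeInstance.encode strE LatticeInstance.encode := (CodeFP.id _).recodeOut fun _ => rfl

/-- The typed data `(n, entries)` off the instance code. [folklore] -/
theorem liTup : CodeFP LatticeInstance.encode (pairE natE (listE smE)) (fun I => (I.n, rowMajor I.n (matRows I.basis))) :=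
  (CodeFP.id _).recodeOut li_encode_eq

/-- **The dimension in unary** (`n ≤ |code I|`). [folklore] -/
theorem liNUn : CodeFP LatticeInstance.encode unE (fun I => I.n) := by
  have h := (unOfNatMin.comp ((strLength.comp liSelf).pair liTup.fst') :)
  refine h.congr fun I => min_eq_left ?_
  exact I.n_le_length_encode

/-- **The basis rows** off the instance code. [folklore] -/
theorem liRows : CodeFP LatticeInstance.encode matE basisRows := by
  have h0 := ((CodeFP.map₀ intOfSM).comp ((rawOfList smE).comp liTup.snd') :)
  have hflat : CodeFP LatticeInstance.encode (rawE intE) (fun I => rowMajor I.n (matRows I.basis)) :=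
    h0.congr fun I => by simp
  have h := (rowsOfFlat_codeFP.comp (liNUn.pair hflat) :)
  exact h.congr fun I => rowsOfFlat_rowMajor_matRows I.basis

/-- A PPT solver's answer function on codes. [cite: AroraBarak2009, Def. 7.1] -/
theorem sol_codeFP (hSol : IsPPT Sol id) : CodeFP (pairE strE strE) strE (fun q => Sol.run q.1 q.2) :=
  of_fn (Function.uncurry Sol.run ∘ boolUnpair) (PolyTimeComputable.comp_holds hSol.1 polyTimeComputable_boolUnpair)
    fun q => by simp [pairE, strE, Function.uncurry]

/-- **The reduction is typed polynomial time** on `(code I, coins)`. [cite: MicciancioRegev2007, Cor. 5.13 ("probabilistic polynomial time reduction"); AroraBarak2009 §1.3] -/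
theorem runOn_codeFP (hSol : IsPPT Sol id) :
    CodeFP (pairE LatticeInstance.encode strE) strE (fun p => runOn Sol pk pP pK pT p.1 p.2) := by
  have hI : CodeFP (pairE LatticeInstance.encode strE) LatticeInstance.encode (fun p => p.1) := (fst _ _ :)
  have hr : CodeFP (pairE LatticeInstance.encode strE) strE (fun p => p.2) := (snd _ _ :)
  have hℓ : CodeFP (pairE LatticeInstance.encode strE) unE (fun p => p.1.encode.length) := (strLength.comp (liSelf.comp hI) :)
  have hn : CodeFP (pairE LatticeInstance.encode strE) unE (fun p => p.1.n) := (liNUn.comp hI :)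
  have hdual : CodeFP (pairE LatticeInstance.encode strE) (pairE intE matE) (fun p => (dualDen p.1, dualRows p.1)) :=
    (invData_codeFP.comp (liRows.comp hI) :)
  have hk : CodeFP (pairE LatticeInstance.encode strE) unE (fun p => pk.eval p.1.encode.length) := ((unPoly pk).comp hℓ :)
  have hP : CodeFP (pairE LatticeInstance.encode strE) unE (fun p => pP.eval p.1.encode.length) := ((unPoly pP).comp hℓ :)
  have hK : CodeFP (pairE LatticeInstance.encode strE) unE (fun p => pK.eval p.1.encode.length) := ((unPoly pK).comp hℓ :)
  have hT : CodeFP (pairE LatticeInstance.encode strE) unE (fun p => pT.eval p.1.encode.length) := ((unPoly pT).comp hℓ :)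
  have hctx : CodeFP (pairE LatticeInstance.encode strE) ctxE
      (fun p => dualCtx p.1 (pk.eval p.1.encode.length) (pP.eval p.1.encode.length)) :=
    (((hn.pair hdual.snd').pair (hk.pair hP)).recodeOut fun p => rfl :)
  have hloop := ((loopOut_codeFP (sol_codeFP Sol hSol)).comp ((hctx.pair (hK.pair hT)).pair hr) :)
  have hV := (hloop.snd' :)
  have hout : CodeFP (pairE LatticeInstance.encode strE) (pairE natE strE)
      (fun p => ((dualDen p.1).toNat, LatticeInstance.encode ⟨p.1.n, toMat p.1.n p.1.n
        (loopOut (dualCtx p.1 (pk.eval p.1.encode.length) (pP.eval p.1.encode.length)) Sol.run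
          (pK.eval p.1.encode.length) (pT.eval p.1.encode.length) p.2).2⟩)) :=
    ((intToNat.comp hdual.fst').pair (latticeTableFP.comp (hn.pair hV)) :)
  exact hout.recodeOut fun p => by rfl

/-- `dualRows` on codes. [folklore] -/
theorem dualRows_codeFP : CodeFP LatticeInstance.encode matE dualRows := (invCols_codeFP.comp liRows :)

/-! ### Numerical facts for the parameter choice -/

/-- `(7/8)³² · 4 < 1`. [folklore] -/
theorem base_lt_one : (7 / 8 : ℝ) ^ 32 * 4 < 1 := by norm_num

/-- **The round budget beats the potential**: `(7/8)^{32W²} 4^{W²} < 1` for `W ≥ 1`. [cite: MicciancioRegev2007, Lemma 5.10 (proof: "terminates after a polynomial number of steps")] -/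
theorem pow_budget_lt_one {W : ℕ} (hW : 1 ≤ W) : (7 / 8 : ℝ) ^ (32 * W ^ 2) * 4 ^ (W ^ 2) < 1 := by
  rw [pow_mul, ← mul_pow]
  exact pow_lt_one₀ (by positivity) base_lt_one (by positivity)

/-- `(1 - p)^k ≤ e^{-kp}` for `0 ≤ p ≤ 1`. [folklore] -/
theorem one_sub_pow_le_exp_neg {p : ℝ} (hp1 : p ≤ 1) (k : ℕ) : (1 - p) ^ k ≤ Real.exp (-(k * p)) := by
  have h1 : 1 - p ≤ Real.exp (-p) := by have := Real.add_one_le_exp (-p); linarith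
  calc (1 - p) ^ k ≤ Real.exp (-p) ^ k := pow_le_pow_left₀ (by linarith) h1 k
    _ = Real.exp (-(k * p)) := by rw [← Real.exp_nat_mul]; ring_nf

/-- **The repetition count beats the round budget**: `32 W² e^{-W} ≤ 1/3` for `W ≥ 48`
(`e^W ≥ W⁴/24 ≥ 96 W²`). [folklore] -/
theorem budget_mul_exp_le {W : ℕ} (hW : 48 ≤ W) : 32 * (W : ℝ) ^ 2 * Real.exp (-(W : ℝ)) ≤ 1 / 3 := by
  have hW' : (48 : ℝ) ≤ W := by exact_mod_cast hW
  have hexp : (W : ℝ) ^ 4 / 24 ≤ Real.exp W := by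
    have h := Real.pow_div_factorial_le_exp (x := (W : ℝ)) (by positivity) 4
    have : (Nat.factorial 4 : ℝ) = 24 := by norm_num [Nat.factorial]
    rwa [this] at h
  have h96 : 96 * (W : ℝ) ^ 2 ≤ (W : ℝ) ^ 4 / 24 := by
    rw [le_div_iff₀ (by norm_num : (0 : ℝ) < 24)]
    have : (2304 : ℝ) ≤ (W : ℝ) ^ 2 := by nlinarith
    nlinarith
  rw [Real.exp_neg]
  have hpos : 0 < Real.exp W := Real.exp_pos _
  rw [mul_inv_le_iff₀ hpos]
  linarith

/-- Polynomial boundedness of the output quality `16 g(n) n`. [folklore] -/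
theorem isPolyBoundedReal_sixteen_mul_mul {g : ℕ → ℝ} (hg : IsPolyBoundedReal g) :
    IsPolyBoundedReal fun n => 16 * g n * n := by
  obtain ⟨q, hq⟩ := hg
  refine ⟨C 16 * q * X, fun n => ?_⟩
  simp only [eval_mul, eval_C, eval_X, Nat.cast_mul, Nat.cast_ofNat]
  have hn : (0 : ℝ) ≤ n := Nat.cast_nonneg _
  exact mul_le_mul_of_nonneg_right (by linarith [hq n]) hn

/-! ### The main theorem -/

/-- **Micciancio–Regev Cor. 5.13 applied to the dual lattice, at machine level, from a machine-level
Thm. 5.9** — and hence the hypothesis of `owfExist_of_gapSVP_worstCaseHard_of_shortDual`.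

HYPOTHESIS `H59` (MR07 Thm. 5.9 at machine level ON THE INTEGRAL DUALS, written inline; no named fact):
under the parameter hypotheses of Thm. 5.23 and for every PPT `SIS′` solver `B` succeeding with
probability `≥ 1/n^c` on the dimensions `n ∈ S`, there are a polynomially bounded `γ = g ≥ 0`
(MR07: `β√n`), a PPT `Sol` with a polynomial coin budget, and `e, n₀` such that on every WELL-FORMED
integer `IncGDD` instance `J = (n, U, V, t, r, pad)` (`MRLemma510Function.IncGDDInst`) whose lattice is the
integral dual `U = dualRows I` (`= Gᵀ`, `L(U) = det(B)² L(B)*`) of a nonsingular `I = (n, B)`, of dimension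
`n ∈ S`, `n ≥ n₀`, and satisfying the promise `r > g(n) · η_{2⁻ⁿ}(L(U))`, `Sol` outputs a good answer
(`‖zU − t‖ ≤ ‖S‖/8 + r`, read by the total reader `readVec`) with probability `≥ 1/n^e`. (These are the
only instances the reduction asks; `shortDual_hypothesis_of_incGDDMachine` is the version quantifying
over all well-formed instances, i.e. Thm. 5.9 for every integer lattice.)

CONCLUSION: the hypothesis of `owfExist_of_gapSVP_worstCaseHard_of_shortDual` with quality `16 g(n) n`:
the reduction `runOn` (the loop of Lemma 5.10 on the integral dual `Gᵀ = det(B)² (B⁻¹)ᵀ`, with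
`k₀ = ℓ^e W(ℓ)` calls per round, `T = 32 W(ℓ)²` rounds, `W = ℓ + Q₁(ℓ)`) is PPT (`runOn_codeFP`), and on a
nonsingular `B` of dimension `n ∈ S`, `n ≥ max n₀ 48`, it outputs a member of `shortDualOutputs I (16 g n n)`
with probability `≥ 2/3`: the run stops with good short rows except with probability
`≤ T(1 − 1/n^e)^{k₀} ≤ 32W² e^{−W} ≤ 1/3` (`MRLemma510Law.toReal_loopOut_bad_le`), and good short rows over
`D = det(B)²` are `λ₁`-short dual sets (`output_mem_shortDualOutputs`).
[cite: MicciancioRegev2007, Cor. 5.13 (p. 25) with Lemma 5.10 (p. 24) and Thm. 5.9 (p. 22); Thm. 5.23 (proof, first step, p. 29)] -/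
theorem shortDual_hypothesis_of_dualIncGDDMachine
    (H59 : ∀ (q m : ℕ → ℕ) [∀ n, NeZero (q n)] (β : ℕ → ℝ),
      IsPolyBounded q → IsPolyBounded m → IsPolyBoundedReal β → IsPolyTimeParams q β m →
      (∀ n, 0 < β n) → MRModulusCondition q m β →
      ∀ B : RandAlg (List Bool) (List Bool), IsPPT B id → ∀ (c : ℕ) (S : Set ℕ),
        (∀ n ∈ S, 1 / (n : ℝ) ^ c ≤ SIS.successProb' B n (m n) (q n) (β n)) →
        ∃ g : ℕ → ℝ, IsPolyBoundedReal g ∧ (∀ n, 0 ≤ g n) ∧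
        ∃ Sol : RandAlg (List Bool) (List Bool), IsPPT Sol id ∧
          (∃ pS : Polynomial ℕ, ∀ k, Sol.coinLen k = pS.eval k) ∧
          ∃ (e n₀ : ℕ), ∀ I : LatticeInstance, I.IsNonsingular → ∀ J : IncGDDInst, J.WellFormed →
            J.n = I.n → J.U = dualRows I → J.n ∈ S → n₀ ≤ J.n → J.Promise (g J.n) →
            1 / (J.n : ℝ) ^ e ≤ Sol.pr id J.encode J.goodAnswers)
    (q m : ℕ → ℕ) [∀ n, NeZero (q n)] (β : ℕ → ℝ)
    (hq : IsPolyBounded q) (hm : IsPolyBounded m) (hβ : IsPolyBoundedReal β) (hpar : IsPolyTimeParams q β m)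
    (hβ0 : ∀ n, 0 < β n) (hmod : MRModulusCondition q m β)
    (B : RandAlg (List Bool) (List Bool)) (hB : IsPPT B id) (c : ℕ) (S : Set ℕ)
    (hS : ∀ n ∈ S, 1 / (n : ℝ) ^ c ≤ SIS.successProb' B n (m n) (q n) (β n)) :
    ∃ g : ℕ → ℝ, IsPolyBoundedReal g ∧
    ∃ R : RandAlg (List Bool) (List Bool), IsPPT R id ∧
      (∃ p : Polynomial ℕ, ∀ k, R.coinLen k = p.eval k) ∧
      ∃ n₀ : ℕ, ∀ I : LatticeInstance, I.IsNonsingular → I.n ∈ S → n₀ ≤ I.n →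
        (2 / 3 : ℝ) ≤ R.pr id I.encode (shortDualOutputs I (g I.n)) := by
  classical
  obtain ⟨g, hg, hg0, Sol, hSol, ⟨pS, hpS⟩, e, n₀, hsucc⟩ := H59 q m β hq hm hβ hpar hβ0 hmod B hB c S hS
  -- polynomial size bounds: the instances along a run, and the dual rows
  obtain ⟨P₀, hP₀⟩ := exists_poly_length_roundInst₀
  obtain ⟨fd, hfd, hfdE⟩ := dualRows_codeFP
  obtain ⟨Q₁, hQ₁⟩ := exists_poly_length_le_of_mem_FP hfd
  -- the parameters
  set W : Polynomial ℕ := X + Q₁ with hWdef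
  set pT : Polynomial ℕ := 32 * W ^ 2 with hpT
  set pk : Polynomial ℕ := X ^ e * W with hpk
  set pP : Polynomial ℕ := P₀.comp (2 * W + 2) with hpP
  set pK : Polynomial ℕ := pS.comp pP with hpK
  -- the machine
  obtain ⟨F, hF, hFeq⟩ := runOn_codeFP Sol pk pP pK pT hSol
  let R : RandAlg (List Bool) (List Bool) := ⟨fun x r => F (boolPair x r), fun ℓ => (pK * (pk * pT)).eval ℓ⟩
  have hRppt : IsPPT R id := by
    refine ⟨?_, ⟨pK * (pk * pT), fun ℓ => le_rfl⟩⟩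
    obtain ⟨pc, Mc, hM⟩ := hF
    exact ⟨pc, Mc, fun z => hM (boolPair z.1 z.2)⟩
  refine ⟨fun n => 16 * g n * n, isPolyBoundedReal_sixteen_mul_mul hg, R, hRppt, ⟨pK * (pk * pT), fun _ => rfl⟩,
    max n₀ 48, fun I hI hIS hnI => ?_⟩
  -- notation for the instance
  have hn0 : n₀ ≤ I.n := le_trans (le_max_left _ _) hnI
  have h48 : 48 ≤ I.n := le_trans (le_max_right _ _) hnI
  have hn1 : 1 ≤ I.n := le_trans (by norm_num) h48
  set ℓ := I.encode.length with hℓ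
  set cx : Ctx := dualCtx I (pk.eval ℓ) (pP.eval ℓ) with hcx
  have hc : cx.WF := wf_dualCtx hI hn1 _ _
  set K := pK.eval ℓ with hKdef
  set T := pT.eval ℓ with hTdef
  set M := (matE (dualRows I)).length with hMdef
  have hMQ : M ≤ Q₁.eval ℓ := by
    have h := hQ₁ I.encode
    rwa [hfdE] at h
  have hnℓ : I.n ≤ ℓ := I.n_le_length_encode
  set Wv := W.eval ℓ with hWv0
  have hWv : Wv = ℓ + Q₁.eval ℓ := by simp [hWv0, hWdef]
  have hnW : I.n ≤ Wv := by omega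
  have hMW : M ≤ Wv := by omega
  have hW48 : 48 ≤ Wv := le_trans h48 hnW
  have hsize : cx.size ≤ 2 * Wv + 2 := by rw [Ctx.size_eq]; change 2 * I.n + 2 + M ≤ _; omega
  -- (hK) every instance met from a good state has code length `P`, hence coin budget `K`
  have hK : ∀ V, GoodRows cx V → Sol.coinLen (roundInst cx V).encode.length = K := by
    intro V hV
    have hP : (roundInst₀ cx V).encode.length ≤ cx.P := by
      refine (hP₀ cx (true, V) (stateOK_of_goodRows hc hV true)).trans ?_
      change P₀.eval cx.size ≤ pP.eval ℓ
      rw [hpP, eval_comp]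
      refine TM2Iter.eval_mono P₀ (hsize.trans (le_of_eq ?_))
      simp [hWv0]
    rw [length_encode_roundInst cx V hP, hpS]
    change pS.eval (pP.eval ℓ) = pK.eval ℓ
    simp only [hpK, hpP, eval_comp]
  -- (hsol) the solver succeeds on promise instances met from good states
  have hsol : ∀ V, GoodRows cx V → (roundInst cx V).Promise (g I.n) →
      1 / (I.n : ℝ) ^ e ≤ Sol.pr id (roundInst cx V).encode (roundInst cx V).goodAnswers := by
    intro V hV hprom
    exact hsucc I hI (roundInst cx V) (wellFormed_roundInst hc hV) rfl rfl hIS hn0 hprom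
  -- (hT) the round budget beats the potential
  have hTpot : (7 / 8 : ℝ) ^ T * potential cx.n cx.U < 1 := by
    have hpot := potential_le_pow hc (goodRows_start hc)
    obtain ⟨-, hA1, -, -⟩ := goodRows_norms hc (goodRows_start hc)
    have hA : (roundA cx.U : ℝ) ≤ (16 : ℝ) ^ M := by
      have h1 : (roundA (dualRows I) : ℝ) ≤ ((M : ℕ) : ℝ) * (4 : ℝ) ^ M := by
        have := roundA_le_code (dualRows I); exact_mod_cast this
      have h2 : ((M : ℕ) : ℝ) ≤ (4 : ℝ) ^ M := by
        have : M < 4 ^ M := Nat.lt_pow_self (by norm_num)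
        exact_mod_cast this.le
      calc (roundA cx.U : ℝ) = roundA (dualRows I) := rfl
        _ ≤ (M : ℝ) * 4 ^ M := h1
        _ ≤ 4 ^ M * 4 ^ M := by gcongr
        _ = 16 ^ M := by rw [← mul_pow]; norm_num
    have hsqrt : Real.sqrt (roundA cx.U) ≤ (4 : ℝ) ^ M := by
      rw [Real.sqrt_le_left (by positivity)]
      calc (roundA cx.U : ℝ) ≤ 16 ^ M := hA
        _ = ((4 : ℝ) ^ M) ^ 2 := by rw [← pow_mul, mul_comm, pow_mul]; norm_num
    have hpot' : potential cx.n cx.U ≤ (4 : ℝ) ^ (Wv ^ 2) := by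
      calc potential cx.n cx.U ≤ Real.sqrt (roundA cx.U) ^ cx.n := hpot
        _ ≤ ((4 : ℝ) ^ M) ^ cx.n := by gcongr
        _ = 4 ^ (M * I.n) := by rw [← pow_mul]
        _ ≤ 4 ^ (Wv ^ 2) := pow_le_pow_right₀ (by norm_num) (by nlinarith)
    have hTv : T = 32 * Wv ^ 2 := by simp [hTdef, hpT, hWv0]
    rw [hTv]
    have h0 : 0 < (7 / 8 : ℝ) ^ (32 * Wv ^ 2) := by positivity
    calc (7 / 8 : ℝ) ^ (32 * Wv ^ 2) * potential cx.n cx.U ≤ (7 / 8 : ℝ) ^ (32 * Wv ^ 2) * 4 ^ (Wv ^ 2) := by gcongr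
      _ < 1 := pow_budget_lt_one (le_trans hn1 hnW)
  -- the law of the run: bad runs are rare
  have hp0 : (0 : ℝ) ≤ 1 / (I.n : ℝ) ^ e := by positivity
  have hp1 : 1 / (I.n : ℝ) ^ e ≤ 1 := by
    rw [div_le_one (by positivity)]
    exact one_le_pow₀ (by exact_mod_cast hn1)
  have hC : K * cx.k₀ * T ≤ R.coinLen ℓ := by
    change K * pk.eval ℓ * T ≤ (pK * (pk * pT)).eval ℓ
    simp only [eval_mul, ← hKdef, ← hTdef]; rw [mul_assoc]
  have hbad := toReal_loopOut_bad_le cx Sol K hc hC (γ := g I.n) hp1 hK hsol hTpot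
  -- the failure bound `T (1 - 1/n^e)^{k₀} ≤ 1/3`
  have hk0 : (T : ℝ) * (1 - 1 / (I.n : ℝ) ^ e) ^ cx.k₀ ≤ 1 / 3 := by
    have hkv : cx.k₀ = ℓ ^ e * Wv := by simp [hcx, hpk, hWv0]
    have hTv : (T : ℝ) = 32 * (Wv : ℝ) ^ 2 := by
      have : T = 32 * Wv ^ 2 := by simp [hTdef, hpT, hWv0]
      rw [this]; push_cast; ring
    have hnpos : (0 : ℝ) < (I.n : ℝ) ^ e := by positivity
    have h1 : (1 - 1 / (I.n : ℝ) ^ e) ^ cx.k₀ ≤ Real.exp (-(Wv : ℝ)) := by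
      refine (one_sub_pow_le_exp_neg hp1 _).trans (Real.exp_le_exp.2 ?_)
      rw [neg_le_neg_iff, hkv]
      -- `ℓ^e W / n^e ≥ W`
      have hle : (I.n : ℝ) ^ e ≤ (ℓ : ℝ) ^ e := pow_le_pow_left₀ (by positivity) (by exact_mod_cast hnℓ) e
      rw [Nat.cast_mul, Nat.cast_pow, mul_one_div, le_div_iff₀ hnpos]
      nlinarith [show (0 : ℝ) ≤ Wv from by positivity]
    calc (T : ℝ) * (1 - 1 / (I.n : ℝ) ^ e) ^ cx.k₀ ≤ 32 * (Wv : ℝ) ^ 2 * Real.exp (-(Wv : ℝ)) := by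
          rw [hTv]; gcongr
      _ ≤ 1 / 3 := budget_mul_exp_le hW48
  -- good runs output short dual sets
  have hgood : ∀ r : List Bool, ((loopOut cx Sol.run K T r).1 = false ∧ GoodRows cx (loopOut cx Sol.run K T r).2 ∧
      Real.sqrt (roundA (loopOut cx Sol.run K T r).2) ≤ 16 * (g I.n * smoothingParameter cx.lattice ((2⁻¹ : ℝ) ^ cx.n))) →
      R.run I.encode r ∈ shortDualOutputs I (16 * g I.n * I.n) := by
    rintro r ⟨-, hV, hshort⟩
    have hrun : R.run I.encode r = runOn Sol pk pP pK pT I r := hFeq (I, r)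
    rw [hrun]
    have hmem := output_mem_shortDualOutputs hI hn1 hV (G := 16 * g I.n) (by have := hg0 I.n; positivity)
      (by rw [mul_assoc]; exact hshort)
    -- `16 g √n ≤ 16 g n`
    have hsub : shortDualOutputs I (16 * g I.n * Real.sqrt I.n) ⊆ shortDualOutputs I (16 * g I.n * I.n) := by
      rintro w ⟨D, U, hw, hD, h1, h2, h3⟩
      refine ⟨D, U, hw, hD, h1, h2, fun i => (h3 i).trans ?_⟩
      have hn1' : (1 : ℝ) ≤ I.n := by exact_mod_cast hn1
      have hsq : Real.sqrt I.n ≤ I.n := Real.sqrt_le_iff.2 ⟨by positivity, by nlinarith⟩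
      have := hg0 I.n
      gcongr
    exact hsub hmem
  -- the probability: `Pr[good output] ≥ Pr[good run] = 1 − Pr[bad run] ≥ 2/3`
  set μ := uniformOfFintype (List.Vector Bool (R.coinLen ℓ)) with hμ
  set Good : Set (List.Vector Bool (R.coinLen ℓ)) := {r | (loopOut cx Sol.run K T r.toList).1 = false ∧
      GoodRows cx (loopOut cx Sol.run K T r.toList).2 ∧
      Real.sqrt (roundA (loopOut cx Sol.run K T r.toList).2) ≤
        16 * (g I.n * smoothingParameter cx.lattice ((2⁻¹ : ℝ) ^ cx.n))} with hGood
  have hpr : R.pr id I.encode (shortDualOutputs I (16 * g I.n * I.n)) =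
      ((μ.map fun r => R.run I.encode r.toList).toOuterMeasure (shortDualOutputs I (16 * g I.n * I.n))).toReal := rfl
  have h1 : (μ.toOuterMeasure Good).toReal ≤ R.pr id I.encode (shortDualOutputs I (16 * g I.n * I.n)) := by
    rw [hpr, PMF.toOuterMeasure_map_apply]
    exact ENNReal.toReal_mono (toOuterMeasure_ne_top' _ _) (measure_mono fun r hr => hgood r.toList hr)
  have h2 : (μ.toOuterMeasure Goodᶜ).toReal ≤ 1 / 3 := le_trans hbad hk0
  have h3 := toReal_toOuterMeasure_add_compl μ Good
  linarith


/-- **The same from Thm. 5.9 for EVERY integer lattice** (the solver is asked on all well-formed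
instances, not only on integral duals). [cite: MicciancioRegev2007, Cor. 5.13 (p. 25) with Lemma 5.10 and Thm. 5.9] -/
theorem shortDual_hypothesis_of_incGDDMachine
    (H59 : ∀ (q m : ℕ → ℕ) [∀ n, NeZero (q n)] (β : ℕ → ℝ),
      IsPolyBounded q → IsPolyBounded m → IsPolyBoundedReal β → IsPolyTimeParams q β m →
      (∀ n, 0 < β n) → MRModulusCondition q m β →
      ∀ B : RandAlg (List Bool) (List Bool), IsPPT B id → ∀ (c : ℕ) (S : Set ℕ),
        (∀ n ∈ S, 1 / (n : ℝ) ^ c ≤ SIS.successProb' B n (m n) (q n) (β n)) →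
        ∃ g : ℕ → ℝ, IsPolyBoundedReal g ∧ (∀ n, 0 ≤ g n) ∧
        ∃ Sol : RandAlg (List Bool) (List Bool), IsPPT Sol id ∧
          (∃ pS : Polynomial ℕ, ∀ k, Sol.coinLen k = pS.eval k) ∧
          ∃ (e n₀ : ℕ), ∀ J : IncGDDInst, J.WellFormed → J.n ∈ S → n₀ ≤ J.n → J.Promise (g J.n) →
            1 / (J.n : ℝ) ^ e ≤ Sol.pr id J.encode J.goodAnswers)
    (q m : ℕ → ℕ) [∀ n, NeZero (q n)] (β : ℕ → ℝ)
    (hq : IsPolyBounded q) (hm : IsPolyBounded m) (hβ : IsPolyBoundedReal β) (hpar : IsPolyTimeParams q β m)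
    (hβ0 : ∀ n, 0 < β n) (hmod : MRModulusCondition q m β)
    (B : RandAlg (List Bool) (List Bool)) (hB : IsPPT B id) (c : ℕ) (S : Set ℕ)
    (hS : ∀ n ∈ S, 1 / (n : ℝ) ^ c ≤ SIS.successProb' B n (m n) (q n) (β n)) :
    ∃ g : ℕ → ℝ, IsPolyBoundedReal g ∧
    ∃ R : RandAlg (List Bool) (List Bool), IsPPT R id ∧
      (∃ p : Polynomial ℕ, ∀ k, R.coinLen k = p.eval k) ∧
      ∃ n₀ : ℕ, ∀ I : LatticeInstance, I.IsNonsingular → I.n ∈ S → n₀ ≤ I.n →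
        (2 / 3 : ℝ) ≤ R.pr id I.encode (shortDualOutputs I (g I.n)) := by
  refine shortDual_hypothesis_of_dualIncGDDMachine ?_ q m β hq hm hβ hpar hβ0 hmod B hB c S hS
  intro q m _ β hq hm hβ hpar hβ0 hmod B hB c S hS
  obtain ⟨g, hg, hg0, Sol, hSol, hpS, e, n₀, h⟩ := H59 q m β hq hm hβ hpar hβ0 hmod B hB c S hS
  exact ⟨g, hg, hg0, Sol, hSol, hpS, e, n₀, fun I _ J hJ _ _ hS' hn hprom => h J hJ hS' hn hprom⟩

/-- **The target fact `owfExist_of_gapSVP_worstCaseHard` from a machine-level MR07 Thm. 5.9** (the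
`IncGDD → SIS` reduction: a PPT solver of well-formed integer `IncGDD^{η_{2⁻ⁿ}}_{g, 8}` instances from any
PPT `SIS′` solver with a polynomial advantage; hypothesis written inline, see
`MRLemma510.shortDual_hypothesis_of_incGDDMachine`): Lemma 5.10 run on the integral dual (this cone,
files `MRLemma510Function` / `MRLemma510Machine` / `MRLemma510Law`) gives Cor. 5.13 on `L(B)*` at machine
level, and `owfExist_of_gapSVP_worstCaseHard_of_shortDual` (the verifier-free route: transference and
Ajtai's SIS-function step) closes the target. What then separates
`Literature.Computability.Cryptography.owfExist_of_gapSVP_worstCaseHard` from a proof is exactly the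
machine of Thm. 5.9 (sampling and combining procedures of Lemmas 5.7–5.8 on a probabilistic machine).
[cite: MicciancioRegev2007, Thm. 5.23 (proof, first step, p. 29) with Cor. 5.13, Lemma 5.10, Thm. 5.9; Ajtai 1996 Thm. 1] -/
theorem owfExist_of_gapSVP_worstCaseHard_of_incGDDMachine
    (H59 : ∀ (q m : ℕ → ℕ) [∀ n, NeZero (q n)] (β : ℕ → ℝ),
      IsPolyBounded q → IsPolyBounded m → IsPolyBoundedReal β → IsPolyTimeParams q β m →
      (∀ n, 0 < β n) → MRModulusCondition q m β →
      ∀ B : RandAlg (List Bool) (List Bool), IsPPT B id → ∀ (c : ℕ) (S : Set ℕ),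
        (∀ n ∈ S, 1 / (n : ℝ) ^ c ≤ SIS.successProb' B n (m n) (q n) (β n)) →
        ∃ g : ℕ → ℝ, IsPolyBoundedReal g ∧ (∀ n, 0 ≤ g n) ∧
        ∃ Sol : RandAlg (List Bool) (List Bool), IsPPT Sol id ∧
          (∃ pS : Polynomial ℕ, ∀ k, Sol.coinLen k = pS.eval k) ∧
          ∃ (e n₀ : ℕ), ∀ J : IncGDDInst, J.WellFormed → J.n ∈ S → n₀ ≤ J.n → J.Promise (g J.n) →
            1 / (J.n : ℝ) ^ e ≤ Sol.pr id J.encode J.goodAnswers) :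
    owfExist_of_gapSVP_worstCaseHard :=
  owfExist_of_gapSVP_worstCaseHard_of_shortDual fun q m _ β hq hm hβ hpar hβ0 hmod B hB c S hS =>
    shortDual_hypothesis_of_incGDDMachine H59 q m β hq hm hβ hpar hβ0 hmod B hB c S hS

/-- **The target fact from a machine-level Thm. 5.9 on the integral duals only** (hypothesis of
`shortDual_hypothesis_of_dualIncGDDMachine`). [cite: MicciancioRegev2007, Thm. 5.23 (proof, first step, p. 29) with Cor. 5.13, Lemma 5.10, Thm. 5.9; Ajtai 1996 Thm. 1] -/
theorem owfExist_of_gapSVP_worstCaseHard_of_dualIncGDDMachine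
    (H59 : ∀ (q m : ℕ → ℕ) [∀ n, NeZero (q n)] (β : ℕ → ℝ),
      IsPolyBounded q → IsPolyBounded m → IsPolyBoundedReal β → IsPolyTimeParams q β m →
      (∀ n, 0 < β n) → MRModulusCondition q m β →
      ∀ B : RandAlg (List Bool) (List Bool), IsPPT B id → ∀ (c : ℕ) (S : Set ℕ),
        (∀ n ∈ S, 1 / (n : ℝ) ^ c ≤ SIS.successProb' B n (m n) (q n) (β n)) →
        ∃ g : ℕ → ℝ, IsPolyBoundedReal g ∧ (∀ n, 0 ≤ g n) ∧
        ∃ Sol : RandAlg (List Bool) (List Bool), IsPPT Sol id ∧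
          (∃ pS : Polynomial ℕ, ∀ k, Sol.coinLen k = pS.eval k) ∧
          ∃ (e n₀ : ℕ), ∀ I : LatticeInstance, I.IsNonsingular → ∀ J : IncGDDInst, J.WellFormed →
            J.n = I.n → J.U = dualRows I → J.n ∈ S → n₀ ≤ J.n → J.Promise (g J.n) →
            1 / (J.n : ℝ) ^ e ≤ Sol.pr id J.encode J.goodAnswers) :
    owfExist_of_gapSVP_worstCaseHard :=
  owfExist_of_gapSVP_worstCaseHard_of_shortDual fun q m _ β hq hm hβ hpar hβ0 hmod B hB c S hS =>
    shortDual_hypothesis_of_dualIncGDDMachine H59 q m β hq hm hβ hpar hβ0 hmod B hB c S hS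


end MRLemma510

end Literature.Algebra.EuclideanLattices

end
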